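import Literature.Computability.AlgebraicComplexity.IP17KroneckerPositivity
import Literature.Computability.AlgebraicComplexity.GaussianCoefficientTable
import HarnessLib

/-!
# A kernel-checkable table of the partitions into distinct odd parts `≤ 2m - 1`

Topic `Literature/Computability/AlgebraicComplexity`; an EVALUATOR file (D-0014): no facts. The
definitions introduced (`OddDistinctTable.mulOnePlusPow`, `OddDistinctTable.coeffs`,
`OddDistinctTable.incrCheck`, `OddDistinctTable.sweepCheck`) are evaluator plumbing; the theorems certify
them against the tree's `oddPartsSubsetCount 1 m n` (`IP17KroneckerPositivity`), the number of subsets of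
`{1, 3, …, 2m-1}` with sum `n`, i.e. the coefficient `a_n` of `q^n` in Pak–Panova's
`𝒜_m(q) = ∏_{i=1}^m (1 + q^{2i-1})` (the `b_n` of Ikenmeyer–Panova 2017, Prop. 6.8).

Purpose. Pak–Panova 2014, Thm. 5.2 (= Ikenmeyer–Panova 2017, Prop. 6.8, the tree's named fact
`ikenmeyerPanova2017_prop_6_8`): "for all `m ≥ 27`, the sequence `(a_{26}, …, a_{m²-26})` is symmetric and
strictly unimodal". The sibling `OddDistinctPartsUnimodality.lean` proves this by induction on `m` from a
finite base range `27 ≤ m ≤ m₀` plus a trigonometric-integral estimate for `m > m₀`; this file supplies the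
base range: ONE upward sweep `𝒜_{m+1}(q) = 𝒜_m(q)·(1 + q^{2m+1})` over coefficient lists, checking
`a_{n} < a_{n+1}` for `26 ≤ n`, `2n + 2 ≤ m²` at every level `27 ≤ m ≤ m₀`, evaluated once by
`decide +kernel` (`O(m₀³)` additions of natural numbers).

## What is proved

* `OddDistinctTable.getD_coeffs` : `(coeffs m).getD n 0 = oddPartsSubsetCount 1 m n` (all `m n`);
* `OddDistinctTable.oddPartsSubsetCount_one_succ_right` : the recurrence
  `a_n(m+1) = a_n(m) + a_{n-2m-1}(m)` behind the sweep;
* `OddDistinctTable.strictIncr_of_sweepCheck` : soundness of the Boolean sweep;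
* `OddDistinctTable.oddPartsSubsetCount_strictIncr_base` : for `27 ≤ m ≤ 120`, `26 ≤ n`, `2n + 2 ≤ m²`:
  `oddPartsSubsetCount 1 m n < oddPartsSubsetCount 1 m (n+1)` (the kernel certificate);
* `OddDistinctTable.coeffs_thirteen_prefix` : the values `a_0(13), …, a_26(13)` =
  `1,1,0,1,1,1,1,1,2,2,2,2,3,3,3,4,5,5,5,6,7,8,8,9,11,12,12` (= `q(n)`, partitions of `n ≤ 26` into distinct
  odd parts; Pak–Panova's Remark 5.3: `q(25) = q(26) = 12`).

HONEST FRAMING: evaluation plumbing for elementary partition counting; nothing here bears on permanent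
versus determinant; VP ≠ VNP is not proved.

## References

* I. Pak, G. Panova, *Unimodality via Kronecker products*, J. Algebraic Combin. 40 (2014) 1103–1120 =
  arXiv:1304.5044, Thm. 5.2 and Rem. 5.3 (held: paper:arxiv-1304.5044, p0008). [PakPanova2014Unimodality]
* C. Ikenmeyer, G. Panova, Adv. Math. 319 (2017) 40–66 = arXiv:1512.03798, Prop. 6.8 (TeX L1430–1437).
  [IkenmeyerPanova2017]

## Mathlib and tree

Mathlib: `Finset.powerset_insert`, `Finset.filter_union`, `Finset.card_union_of_disjoint`,
`List.getD_cons_zero/succ`, `List.getD_eq_getElem?_getD`, `decide +kernel`.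
Tree: `oddPartsSubsetCount` (`IP17KroneckerPositivity`, t05 g0), `GaussTable.addCoeffs`
(`GaussianCoefficientTable`, t05 g4).

Provenance: val-lit cell, seat t05 g5 (discharge of `ikenmeyerPanova2017_prop_6_8`).
-/

namespace Literature.Computability.AlgebraicComplexity

namespace OddDistinctTable

/-! ### The evaluator -/

/-- Multiply a coefficient list by `1 + q^p`: `L + q^p · L`. [folklore] -/
def mulOnePlusPow (p : ℕ) (L : List ℕ) : List ℕ :=
  GaussTable.addCoeffs L (List.replicate p 0 ++ L)

/-- `coeffs m = [a_0(m), a_1(m), …, a_{m²}(m)]`, the coefficient list of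
`𝒜_m(q) = ∏_{i=1}^m (1 + q^{2i-1})` (Pak–Panova 2014, Thm. 5.2), computed by the upward recurrence
`𝒜_{m+1} = 𝒜_m · (1 + q^{2m+1})`. [cite: PakPanova2014Unimodality, Thm. 5.2 (held p0008)] -/
def coeffs : ℕ → List ℕ
  | 0 => [1]
  | m + 1 => mulOnePlusPow (2 * m + 1) (coeffs m)

/-- `incrPairs L k`: the first `k + 1` entries of `L` exist and strictly increase
(`L_0 < L_1 < ⋯ < L_k`), checked in one pass. [folklore] -/
def incrPairs : List ℕ → ℕ → Bool
  | _, 0 => true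
  | a :: b :: t, k + 1 => decide (a < b) && incrPairs (b :: t) k
  | _, _ + 1 => false

/-- The Boolean check "`L_n < L_{n+1}` for all `26 ≤ n ≤ N/2 - 1`" (equivalently `26 ≤ n`, `2n + 2 ≤ N`)
on a coefficient list, in ONE pass over the list: Pak–Panova's "`a_n < a_{n+1}` for all
`26 ≤ n < (m²-1)/2`" at `N = m²`. [cite: PakPanova2014Unimodality, Thm. 5.2 (proof, held p0008)] -/
def incrCheck (L : List ℕ) (N : ℕ) : Bool :=
  incrPairs (L.drop 26) (N / 2 - 26)

/-- The upward sweep: from `L = coeffs m`, check `incrCheck (coeffs m') (m'^2)` for every level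
`m < m' ≤ m + k` with `27 ≤ m'`. [cite: PakPanova2014Unimodality, Thm. 5.2 (held p0008)] -/
def sweepCheck : List ℕ → ℕ → ℕ → Bool
  | _, _, 0 => true
  | L, m, k + 1 =>
      let L' := mulOnePlusPow (2 * m + 1) L
      (decide (m + 1 < 27) || incrCheck L' ((m + 1) ^ 2)) && sweepCheck L' (m + 1) k

/-! ### Correctness -/

/-- `L` lists the coefficients `a_s(m)`, `s = 0, 1, …` (zeros beyond its end). [folklore] -/
private def Represents (L : List ℕ) (m : ℕ) : Prop :=
  ∀ s, L.getD s 0 = oddPartsSubsetCount 1 m s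

/-- Entries of the coefficientwise sum. [folklore] -/
private theorem getD_addCoeffs : ∀ (xs ys : List ℕ) (s : ℕ),
    (GaussTable.addCoeffs xs ys).getD s 0 = xs.getD s 0 + ys.getD s 0
  | [], ys, s => by simp [GaussTable.addCoeffs]
  | x :: xs, [], s => by simp [GaussTable.addCoeffs]
  | x :: xs, y :: ys, 0 => by simp [GaussTable.addCoeffs]
  | x :: xs, y :: ys, s + 1 => by
      rw [GaussTable.addCoeffs, List.getD_cons_succ, List.getD_cons_succ, List.getD_cons_succ]
      exact getD_addCoeffs xs ys s

/-- Entries of a list shifted up by `k` zeros (multiplication by `q^k`). [folklore] -/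
private theorem getD_replicate_append (acc : List ℕ) :
    ∀ (k s : ℕ), (List.replicate k 0 ++ acc).getD s 0 = if k ≤ s then acc.getD (s - k) 0 else 0
  | 0, s => by simp
  | k + 1, 0 => by simp [List.replicate_succ]
  | k + 1, s + 1 => by
      rw [List.replicate_succ, List.cons_append, List.getD_cons_succ, getD_replicate_append acc k s]
      simp only [Nat.add_le_add_iff_right, Nat.add_sub_add_right]

/-- Entries of `L · (1 + q^p)`. [folklore] -/
private theorem getD_mulOnePlusPow (p : ℕ) (L : List ℕ) (s : ℕ) :
    (mulOnePlusPow p L).getD s 0 = L.getD s 0 + if p ≤ s then L.getD (s - p) 0 else 0 := by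
  rw [mulOnePlusPow, getD_addCoeffs, getD_replicate_append]

/-- **The recurrence `a_s(m+1) = a_s(m) + a_{s-(2m+1)}(m)`**: a set of distinct odd parts `≤ 2m + 1`
with sum `s` either avoids the part `2m + 1` or contains it; i.e.
`𝒜_{m+1}(q) = 𝒜_m(q) (1 + q^{2m+1})`. [cite: PakPanova2014Unimodality, Thm. 5.2 (the product `𝒜_m(q)`, held p0008)] -/
theorem oddPartsSubsetCount_one_succ_right (m s : ℕ) :
    oddPartsSubsetCount 1 (m + 1) s =
      oddPartsSubsetCount 1 m s + if 2 * m + 1 ≤ s then oddPartsSubsetCount 1 m (s - (2 * m + 1)) else 0 := by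
  unfold oddPartsSubsetCount
  have hU : Finset.Icc 1 (m + 1) = insert (m + 1) (Finset.Icc 1 m) := by
    ext i
    simp only [Finset.mem_insert, Finset.mem_Icc]
    omega
  have h1 : (m + 1 : ℕ) ∉ Finset.Icc 1 m := by simp
  have hnot : ∀ S ∈ (Finset.Icc 1 m).powerset, (m + 1 : ℕ) ∉ S := fun S hS h =>
    h1 (Finset.mem_powerset.mp hS h)
  rw [hU, Finset.powerset_insert, Finset.filter_union, Finset.card_union_of_disjoint]
  · congr 1
    rw [Finset.filter_image, Finset.card_image_of_injOn]
    · split_ifs with hs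
      · congr 1
        apply Finset.filter_congr
        intro S hS
        rw [Finset.sum_insert (hnot S hS)]
        omega
      · rw [Finset.card_eq_zero, Finset.filter_eq_empty_iff]
        intro S hS
        rw [Finset.sum_insert (hnot S hS)]
        omega
    · intro S₁ hS₁ S₂ hS₂ h
      have e₁ := Finset.erase_insert (hnot S₁ (Finset.mem_filter.mp (Finset.mem_coe.mp hS₁)).1)
      have e₂ := Finset.erase_insert (hnot S₂ (Finset.mem_filter.mp (Finset.mem_coe.mp hS₂)).1)
      rw [← e₁, ← e₂, h]
  · rw [Finset.disjoint_left]
    intro S hS hS'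
    rw [Finset.mem_filter] at hS hS'
    obtain ⟨S', -, rfl⟩ := Finset.mem_image.mp hS'.1
    exact hnot _ hS.1 (Finset.mem_insert_self _ S')

/-- The one-term list `[1]` lists `a_s(0) = [s = 0]` (empty product). [folklore] -/
private theorem represents_one_zero : Represents [1] 0 := by
  intro s
  unfold oddPartsSubsetCount
  rw [show Finset.Icc 1 0 = (∅ : Finset ℕ) by rfl, Finset.powerset_empty, Finset.filter_singleton,
    Finset.sum_empty]
  cases s with
  | zero => simp
  | succ s => simp

/-- **The recurrence on lists**: if `L` lists `a_s(m)` then `L·(1 + q^{2m+1})` lists `a_s(m+1)`.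
[cite: PakPanova2014Unimodality, Thm. 5.2 (the product `𝒜_m(q)`, held p0008)] -/
private theorem represents_step {L : List ℕ} {m : ℕ} (hL : Represents L m) :
    Represents (mulOnePlusPow (2 * m + 1) L) (m + 1) := by
  intro s
  rw [getD_mulOnePlusPow, hL s, oddPartsSubsetCount_one_succ_right]
  split_ifs with h
  · rw [hL]
  · rfl

/-- `coeffs m` lists `a_s(m)`. [cite: PakPanova2014Unimodality, Thm. 5.2 (held p0008)] -/
private theorem represents_coeffs : ∀ m, Represents (coeffs m) m
  | 0 => represents_one_zero
  | m + 1 => represents_step (represents_coeffs m)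

/-- **The table is correct**: the `n`-th entry of `coeffs m` is `a_n(m) = oddPartsSubsetCount 1 m n`, the
number of partitions of `n` into distinct odd parts `≤ 2m - 1` — for every `m, n` (entries beyond the end
of the list read `0`). [cite: PakPanova2014Unimodality, Thm. 5.2 (held p0008)] -/
theorem getD_coeffs (m n : ℕ) : (coeffs m).getD n 0 = oddPartsSubsetCount 1 m n :=
  represents_coeffs m n

/-- Soundness of the Boolean check on one list. [cite: PakPanova2014Unimodality, Thm. 5.2 (proof, held p0008)] -/
private theorem lt_of_incrPairs : ∀ (L : List ℕ) (k : ℕ), incrPairs L k = true →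
    ∀ i, i < k → L.getD i 0 < L.getD (i + 1) 0
  | _, 0, _, i, hi => absurd hi (Nat.not_lt_zero _)
  | [], k + 1, h, _, _ => by simp [incrPairs] at h
  | [a], k + 1, h, _, _ => by simp [incrPairs] at h
  | a :: b :: t, k + 1, h, i, hi => by
      rw [incrPairs, Bool.and_eq_true, decide_eq_true_iff] at h
      cases i with
      | zero => simpa using h.1
      | succ i =>
        rw [List.getD_cons_succ, List.getD_cons_succ]
        have := lt_of_incrPairs (b :: t) k h.2 i (by omega)
        rwa [List.getD_cons_succ] at this

/-- Entries of a dropped list. [folklore] -/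
private theorem getD_drop (L : List ℕ) (j i : ℕ) : (L.drop j).getD i 0 = L.getD (j + i) 0 := by
  simp [List.getD_eq_getElem?_getD]

/-- Soundness of the Boolean check on one list. [cite: PakPanova2014Unimodality, Thm. 5.2 (proof, held p0008)] -/
private theorem lt_of_incrCheck {L : List ℕ} {N : ℕ} (h : incrCheck L N = true) {n : ℕ} (h26 : 26 ≤ n)
    (hn : 2 * n + 2 ≤ N) : L.getD n 0 < L.getD (n + 1) 0 := by
  unfold incrCheck at h
  have := lt_of_incrPairs _ _ h (n - 26) (by omega)
  rw [getD_drop, getD_drop] at this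
  rwa [show 26 + (n - 26) = n by omega, show 26 + (n - 26 + 1) = n + 1 by omega] at this

/-- **Soundness of the sweep**: if `L` lists `a_s(m)` and `sweepCheck L m k` evaluates to `true`, then
`a_n(m') < a_{n+1}(m')` for every level `m < m' ≤ m + k` with `27 ≤ m'` and every `26 ≤ n`, `2n + 2 ≤ m'²`.
[cite: PakPanova2014Unimodality, Thm. 5.2 (proof, held p0008)] -/
private theorem strictIncr_of_sweepCheck_aux : ∀ (k : ℕ) (L : List ℕ) (m : ℕ), Represents L m →
    sweepCheck L m k = true → ∀ m', m < m' → m' ≤ m + k → 27 ≤ m' →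
    ∀ n, 26 ≤ n → 2 * n + 2 ≤ m' ^ 2 →
      oddPartsSubsetCount 1 m' n < oddPartsSubsetCount 1 m' (n + 1)
  | 0, L, m, _, _, m', h1, h2, _, _, _, _ => absurd h2 (by omega)
  | k + 1, L, m, hL, h, m', h1, h2, h27, n, h26, hn => by
      rw [sweepCheck, Bool.and_eq_true] at h
      have hL' := represents_step hL
      by_cases hm : m' = m + 1
      · subst hm
        have h0 := h.1
        rw [Bool.or_eq_true, decide_eq_true_iff] at h0
        rcases h0 with h0 | h0
        · exact absurd h0 (by omega)
        · have := lt_of_incrCheck h0 h26 hn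
          rwa [hL' n, hL' (n + 1)] at this
      · exact strictIncr_of_sweepCheck_aux k _ (m + 1) hL' h.2 m' (by omega) (by omega) h27 n h26 hn

/-- **Soundness of the sweep from scratch**: `sweepCheck [1] 0 K = true` certifies
`a_n(m) < a_{n+1}(m)` for all `27 ≤ m ≤ K`, `26 ≤ n`, `2n + 2 ≤ m²`.
[cite: PakPanova2014Unimodality, Thm. 5.2 (proof, held p0008)] -/
theorem strictIncr_of_sweepCheck {K : ℕ} (h : sweepCheck [1] 0 K = true) {m : ℕ} (h27 : 27 ≤ m)
    (hK : m ≤ K) {n : ℕ} (h26 : 26 ≤ n) (hn : 2 * n + 2 ≤ m ^ 2) :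
    oddPartsSubsetCount 1 m n < oddPartsSubsetCount 1 m (n + 1) :=
  strictIncr_of_sweepCheck_aux K [1] 0 represents_one_zero h m (by omega) (by omega) h27 n h26 hn

/-! ### The kernel certificates -/

/-- The sweep up to `m = 120` passes (one kernel evaluation, `≈ 6·10⁵` list-cell additions, about a
kernel-minute).
[cite: PakPanova2014Unimodality, Thm. 5.2 (held p0008)] -/
theorem sweepCheck_upTo : sweepCheck [1] 0 120 = true := by
  decide +kernel

/-- **Base range of Pak–Panova 2014, Thm. 5.2 / Ikenmeyer–Panova 2017, Prop. 6.8 (increasing half)**: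
for `27 ≤ m ≤ 120`, `26 ≤ n` and `2n + 2 ≤ m²`, `a_n(m) < a_{n+1}(m)`, where
`a_n(m) = oddPartsSubsetCount 1 m n` counts the partitions of `n` into distinct odd parts `≤ 2m - 1`.
[cite: PakPanova2014Unimodality, Thm. 5.2 (held p0008); IkenmeyerPanova2017, Prop. 6.8 (TeX L1430–1437)] -/
theorem oddPartsSubsetCount_strictIncr_base {m : ℕ} (h27 : 27 ≤ m) (h120 : m ≤ 120) {n : ℕ}
    (h26 : 26 ≤ n) (hn : 2 * n + 2 ≤ m ^ 2) :
    oddPartsSubsetCount 1 m n < oddPartsSubsetCount 1 m (n + 1) :=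
  strictIncr_of_sweepCheck sweepCheck_upTo h27 h120 h26 hn

/-- The first `27` coefficients at `m = 13`: `a_n(13) = q(n)` for `n ≤ 26` (partitions of `n` into
distinct odd parts; Pak–Panova's Rem. 5.3: "`q(25) = q(26) = 12`").
[cite: PakPanova2014Unimodality, Rem. 5.3 (held p0008)] -/
theorem coeffs_thirteen_prefix :
    ((List.range 27).map fun n => (coeffs 13).getD n 0) =
      [1, 1, 0, 1, 1, 1, 1, 1, 2, 2, 2, 2, 3, 3, 3, 4, 5, 5, 5, 6, 7, 8, 8, 9, 11, 12, 12] := by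
  decide +kernel

/-- The same values as a statement about `oddPartsSubsetCount 1 13`. [cite: PakPanova2014Unimodality, Rem. 5.3 (held p0008)] -/
theorem oddPartsSubsetCount_thirteen_values :
    ((List.range 27).map fun n => oddPartsSubsetCount 1 13 n) =
      [1, 1, 0, 1, 1, 1, 1, 1, 2, 2, 2, 2, 3, 3, 3, 4, 5, 5, 5, 6, 7, 8, 8, 9, 11, 12, 12] := by
  rw [← coeffs_thirteen_prefix]
  apply List.map_congr_left
  intro n _
  rw [getD_coeffs]

end OddDistinctTable

end Literature.Computability.AlgebraicComplexity
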